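import Literature.Analysis.FluidPDE.CylindricalGenerator
import Literature.Analysis.FluidPDE.StatisticalSolutionDirac
import HarnessLib

/-!
# Stub `stub_defectIdentity` of line `Sketch` (crux stmt-AnomalousDissipation-15510, `EnsembleRigidity.ResidualTransferSSS`)

**The Euler defect identity of a stationary statistical solution.** For a stationary statistical
solution `μ` of the space-periodic Navier–Stokes equations NS_ν(f) on `T^d`
(`Torus.IsStationaryStatisticalSolution ν f μ`, Foias–Manley–Rosa–Temam 2001, Ch. IV Def. 1.3) with
`ν ≠ 0`, `f ∈ L²` and a cylindrical test functional `Φ`, the forced-Euler generator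
`u ↦ ⟨F_0(u), Φ'(u)⟩ = (f, Φ'(u)) + ∫ (u ⊗ u) : ∇Φ'(u)` (`Torus.nsGeneratorPairing 0 f u (Φ.grad u)`) is
`μ`-integrable and

  `∫ ⟨F_0(u), Φ'(u)⟩ dμ(u) = −ν ∫ (u, ΔΦ'(u)) dμ(u)`.

Proof: by definition of `Torus.nsGeneratorPairing`, pointwise
`⟨F_ν(u), w⟩ = ⟨F_0(u), w⟩ + ν (u, Δw)`; the `ν = 0` generator is continuous on `H`
(`Torus.continuous_nsGeneratorPairing_grad`) and grows at most like `K (1 + |u|²)`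
(`Torus.exists_abs_nsGeneratorPairing_grad_le`), hence is `μ`-integrable by the finite mean energy
(`IsStationaryStatisticalSolution.integrable_norm_sq`); the stationary Liouville equation
`∫ ⟨F_ν(u), Φ'(u)⟩ dμ = 0` (FMRT IV (1.30), the field `IsStationaryStatisticalSolution.generator`)
then gives the identity. In the crux skeleton this feeds `eulerDefect_le`.

## References

* C. Foias, O. Manley, R. Rosa, R. Temam, *Navier–Stokes Equations and Turbulence* (CUP 2001),
  Ch. IV §1.1 (1.11), §1.2 Def. 1.3, (1.29)–(1.30). [FoiasManleyRosaTemam2001]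
-/

-- `Summit.<Summit>.<Problem>` is the tree's mandated summit-side namespace (CONVENTIONS §2); single-conjunct summit, duplicate deliberate.
set_option linter.dupNamespace false

noncomputable section

namespace Summit.AnomalousDissipation.AnomalousDissipation.Theorems.ResidualTransferSSS

open MeasureTheory Filter Topology UnitAddTorus
open scoped InnerProductSpace RealInnerProductSpace ENNReal NNReal
open Literature.Analysis.FunctionSpaces Literature.Analysis.FluidPDE

variable {d : Type*} [Fintype d] [DecidableEq d]

/-- **Viscous splitting of the tested generator**: pointwise on `H`,
`⟨F_ν(u), w⟩ = ⟨F_0(u), w⟩ + ν (u, Δw)` — immediate from the definition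
`⟨F_ν(u), w⟩ = (f, w) + ν (u, Δw) + ∫ (u ⊗ u) : ∇w` of `Torus.nsGeneratorPairing`
(FMRT 2001, Ch. IV (1.11)). [folklore] -/
theorem nsGeneratorPairing_eq_zero_add_viscous (ν : ℝ) (f : UnitAddTorus d → EuclideanSpace ℝ d)
    (u : Torus.energySpace d) (w : UnitAddTorus d → EuclideanSpace ℝ d) :
    Torus.nsGeneratorPairing ν f u w =
      Torus.nsGeneratorPairing 0 f u w +
        ν * ∫ x, ⟪((u : Lp (EuclideanSpace ℝ d) 2 (volume : Measure (UnitAddTorus d))) :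
          UnitAddTorus d → EuclideanSpace ℝ d) x, Torus.laplacian w x⟫_ℝ := by
  unfold Torus.nsGeneratorPairing
  ring

/-- **Integrability of the forced-Euler generator** against a stationary statistical solution: for
`f ∈ L²` and a cylindrical `Φ`, `u ↦ ⟨F_0(u), Φ'(u)⟩` is `μ`-integrable (continuous on `H` with
growth `≤ K (1 + |u|²)`, and `∫ |u|² dμ < ∞` by (1.29) and Poincaré). [folklore] -/
theorem integrable_nsGeneratorPairing_zero_grad {ν : ℝ} {f : UnitAddTorus d → EuclideanSpace ℝ d}
    (hf : MemLp f 2 volume) {μ : Measure (Torus.energySpace d)}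
    (hμ : Torus.IsStationaryStatisticalSolution ν f μ) (Φ : Torus.CylindricalTest d) :
    Integrable (fun u : Torus.energySpace d => Torus.nsGeneratorPairing 0 f u (Φ.grad u)) μ := by
  haveI := hμ.prob
  obtain ⟨K, _, hK⟩ := Torus.exists_abs_nsGeneratorPairing_grad_le (0 : ℝ) hf Φ
  refine Integrable.mono' (((integrable_const (1 : ℝ)).fun_add hμ.integrable_norm_sq).const_mul K)
    (Torus.continuous_nsGeneratorPairing_grad (0 : ℝ) (hf.integrable one_le_two) Φ).aestronglyMeasurable
    (ae_of_all _ fun u => ?_)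
  rw [Real.norm_eq_abs]
  exact hK u

/-- **The Euler defect of a stationary statistical solution** (FMRT 2001, Ch. IV (1.30)): for
`ν ≠ 0`, `f ∈ L²` and a cylindrical `Φ`, the forced-Euler generator `v ↦ ⟨f − B(v,v), Φ'(v)⟩` is
`μ`-integrable and `∫ ⟨f − B(v,v), Φ'(v)⟩ dμ = −ν ∫ (v, ΔΦ'(v)) dμ` (pointwise
`⟨F_ν(v), w⟩ = ⟨F_0(v), w⟩ + ν (v, Δw)` by definition of `nsGeneratorPairing`, and the Liouville
equation `∫ ⟨F_ν(v), Φ'(v)⟩ dμ = 0`). [folklore] -/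
theorem stub_defectIdentity {ν : ℝ} (hν : ν ≠ 0) {f : UnitAddTorus d → EuclideanSpace ℝ d}
    (hf : MemLp f 2 volume) {μ : Measure (Torus.energySpace d)}
    (hμ : Torus.IsStationaryStatisticalSolution ν f μ) (Φ : Torus.CylindricalTest d) :
    Integrable (fun u : Torus.energySpace d => Torus.nsGeneratorPairing 0 f u (Φ.grad u)) μ ∧
      ∫ u, Torus.nsGeneratorPairing 0 f u (Φ.grad u) ∂μ =
        -(ν * ∫ u : Torus.energySpace d,
          (∫ x, ⟪((u : Lp (EuclideanSpace ℝ d) 2 (volume : Measure (UnitAddTorus d))) :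
            UnitAddTorus d → EuclideanSpace ℝ d) x, Torus.laplacian (Φ.grad u) x⟫_ℝ) ∂μ) := by
  obtain ⟨hGνI, hGν0⟩ := hμ.generator Φ
  have hG0I := integrable_nsGeneratorPairing_zero_grad hf hμ Φ
  -- the viscous term `u ↦ (u, ΔΦ'(u)) = (⟨F_ν(u), Φ'(u)⟩ − ⟨F_0(u), Φ'(u)⟩) / ν` is integrable
  have hLI : Integrable (fun u : Torus.energySpace d =>
      ∫ x, ⟪((u : Lp (EuclideanSpace ℝ d) 2 (volume : Measure (UnitAddTorus d))) :
        UnitAddTorus d → EuclideanSpace ℝ d) x, Torus.laplacian (Φ.grad u) x⟫_ℝ) μ := by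
    refine ((hGνI.sub' hG0I).div_const ν).congr (ae_of_all _ fun u => ?_)
    show (Torus.nsGeneratorPairing ν f u (Φ.grad u) - Torus.nsGeneratorPairing 0 f u (Φ.grad u)) / ν = _
    rw [nsGeneratorPairing_eq_zero_add_viscous ν f u (Φ.grad u), add_sub_cancel_left,
      mul_div_cancel_left₀ _ hν]
  refine ⟨hG0I, ?_⟩
  -- integrate the pointwise splitting against `μ` and use the Liouville equation
  have hsum : ∫ u, Torus.nsGeneratorPairing ν f u (Φ.grad u) ∂μ =
      ∫ u, Torus.nsGeneratorPairing 0 f u (Φ.grad u) ∂μ +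
        ν * ∫ u : Torus.energySpace d,
          (∫ x, ⟪((u : Lp (EuclideanSpace ℝ d) 2 (volume : Measure (UnitAddTorus d))) :
            UnitAddTorus d → EuclideanSpace ℝ d) x, Torus.laplacian (Φ.grad u) x⟫_ℝ) ∂μ := by
    rw [← integral_const_mul, ← integral_add hG0I (hLI.const_mul ν)]
    exact integral_congr_ae (ae_of_all _ fun u =>
      nsGeneratorPairing_eq_zero_add_viscous ν f u (Φ.grad u))
  linarith [hGν0, hsum]

end Summit.AnomalousDissipation.AnomalousDissipation.Theorems.ResidualTransferSSS

end
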